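import Literature.Probability.MarkovChains.MeanFirstPassageTreeFormula
import Literature.Probability.MarkovChains.CommuteTimeSymmetrization
import HarnessLib

/-!
# Chung's formula for the Green function of a chain stopped at a state, Pitman–Tang's «tree
# algebra» identities (3.6)–(3.7), and the cost of Wilson's algorithm (Lyons–Peres Ex. 4.25)

HONEST FRAMING (as everywhere in this directory): finite state space, no path space — the Green
function `G_{τ_k}` and the mean hitting times are the tree's first-step solutions (`IsGreenSolution`,
`IsHittingTimeSolution`), the mean return time is `E_j T_j⁺ = 1 + Σ_y p_{jy} m_{yj}`.

Lane `lit-hodgefound`, seat p23, generation 47, row g47-#5 of the programme «Tree and forest formulas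
for finite Markov chains» [PitmanTang2018] (rows #1–#4: `MatrixForestTheoremInverse`, `GreenTreeFormula`,
`MeanFirstPassageTreeFormula`, `AbsorbingChainForestFormulas`).

## Source, verbatim ([PitmanTang2018], held text `paper:arxiv-1603.09017`, §3 p. 9, «Chung's formula
and tree algebra»)

«Now by setting `R = {k}` in the Green tree formula (1.7), we get:
`E_i Σ_{n=0}^{T_k−1} 1(X_n = j) = w_{ij}({k,j}) / Σ_k` for `i, j ≠ k` (3.5). According to Chung [Chung]
and Pitman [Pitman77], for a positive recurrent chain,
`E_i Σ_{n=0}^{T_k−1} 1(X_n = j) = (m_{ik} + m_{kj} − m_{ij} 1(i ≠ j)) / m_{jj}` for `i, j ≠ k`. Further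
by Theorem 1.3, we have: `E_i Σ_{n=0}^{T_k−1} 1(X_n = j) =
(Σ_{ik}Σ_j + Σ_{kj}Σ_k − Σ_{ij}Σ_k 1(i ≠ j)) / (Σ_k Σ^{(1)})` for `i, j ≠ k`. By identifying (3.5) and
[this], we obtain the following tree algebra identities:
`w_{ii}({k,i}) Σ^{(1)} = Σ_{ik}Σ_i + Σ_{ki}Σ_k` for `i ≠ k` (3.6),
`w_{ij}({k,j}) Σ^{(1)} + Σ_{ij}Σ_k = Σ_{ik}Σ_j + Σ_{kj}Σ_k` for `i ≠ j` and `i, j ≠ k` (3.7). It seems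
that these identities are non-trivial, and there is no simple bijective proof. So we leave the
interpretation open for readers.»

## What is here (`P` irreducible row-stochastic on a finite `X`; `Σ_j = treeMeasure P j`,
`Σ^{(1)} = Σ_l treeMeasure P l`, `Σ_{ij} = passageForestSum`, `w_{ij}(·) = forestWeightTo`)

* §1 **Chung's formula** in the tree's conventions (`h j j = 0`, so no indicator is needed):
  `G_{τ_k}(i, j) · E_j T_j⁺ = m_{ik} + m_{kj} − m_{ij}` for `j ≠ k` and every `i`
  (`IsGreenSolution.chung_formula`) — assembled, exactly as the occupation-measure argument goes, from
  the tree's `GreenFunction.col_eq_mul` (`G(i,j) = P_i[τ_j < τ_k] G(j,j)`), `diag_mul_escape`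
  (`G(j,j) · P_j[τ_k < τ_j⁺] = 1`), and `CommuteTimeSymmetrization`'s
  `returnTime_eq_commuteTime_mul_escape` (`E_j T_j⁺ = t_{j↔k} P_j[τ_k < τ_j⁺]`) and
  `hitting_sub_hitting_harmonicExt` (`m_{ik} − m_{ij} + m_{kj} = t_{j↔k} P_i[τ_j < τ_k]`).
* §2 Pitman–Tang's spanning-forest form of it, `G_{τ_k}(i,j) = (Σ_{ik}Σ_j + Σ_{kj}Σ_k − Σ_{ij}Σ_k) /
  (Σ_k Σ^{(1)})` (`IsGreenSolution.PitmanTang2018_green_forests`), and the **tree algebra identities**: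
  `PitmanTang2018_eq_3_7` — `w_{ij}({j,k}) Σ^{(1)} + Σ_{ij}Σ_k = Σ_{ik}Σ_j + Σ_{kj}Σ_k` for `j ≠ k` and
  EVERY `i` (the printed (3.7) for `i ≠ j`, `i ≠ k`; for `i = j` it is (3.6), for `i = k` it is
  `0 = 0` termwise), and `PitmanTang2018_eq_3_6` — `w({j,k}) Σ^{(1)} = Σ_{jk}Σ_j + Σ_{kj}Σ_k`.
  (`{j, k}` here is the paper's `{k, j}`: the same root set.)
* §3 **Lyons–Peres Exercise 4.25** (the expected number of steps of Wilson's algorithm rooted at `r`):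
  `Σ_x π(x)(E_x τ_r + E_r τ_x) = Σ_{x ≠ r} w({x, r}) / Σ_r = trace (I − P_r)⁻¹`
  (`LyonsPeres2016_exercise_4_25`, `LyonsPeres2016_exercise_4_25_trace`: (3.6) summed over `x`, and the
  diagonal of the Green tree formula).

THEOREMS ONLY (no definition, no named fact, no instance); the identities are proved, as printed, by
identifying the Green tree formula (row #2) with Chung's formula and Theorem 1.3 ∕ eq. (1.1) (row #3) —
not bijectively.

## References

* [PitmanTang2018] §3, eqs. (3.5)–(3.7); Thm. 1.2 (1.5).
* [LyonsPeres2016] §4.6, Exercise 4.25.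
* K. L. Chung, *Markov chains with stationary transition probabilities* (cited as [Chung] there);
  J. Pitman, *Occupation measures for Markov chains*, Adv. Appl. Probab. 9 (1977) ([Pitman77] there).
* [LevinPeres2017] §9.4, §10.3; [LyonsPeres2016] §2.11 Exercise 2.120 (tree `GreenFunction`,
  `CommuteTimeSymmetrization`).
-/

namespace Literature.Probability.MarkovChains

open Finset Matrix Function Literature.Combinatorics.Enumerative

variable {X : Type*} [Fintype X] [DecidableEq X] {P : Matrix X X ℝ}

/-! ### §1 Chung's formula -/

section Chung

/-- **Chung's formula** for the Green function of the chain stopped at `τ_k`: for `j ≠ k` and every `i`,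
`G_{τ_k}(i, j) · E_j T_j⁺ = m_{ik} + m_{kj} − m_{ij}`, i.e. `E_i Σ_{n < T_k} 1(X_n = j) =
(m_{ik} + m_{kj} − m_{ij} 1(i ≠ j)) / m_{jj}` (the tree's `h j j = 0` absorbs the indicator).
[cite: PitmanTang2018, §3 (Chung's formula, after eq. (3.5): «According to Chung and Pitman, for a
positive recurrent chain …»)] [cite: LevinPeres2017, §9.4 Lemma 9.6 (proof: the geometric number of
visits) and §10.3 (10.13)] [cite: LyonsPeres2016, §2.11 Exercise 2.120] -/
theorem IsGreenSolution.chung_formula (hP : IsRowStochastic P) (hirr : IsIrreducible P) {k : X}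
    {G : X → X → ℝ} (hG : IsGreenSolution P k G) {h : X → X → ℝ} (hh : IsHittingTimeSolution P h)
    {j : X} (hjk : j ≠ k) (i : X) :
    G i j * (1 + ∑ y, P j y * h y j) = h i k + h k j - h i j := by
  -- the two harmonic extensions off `{j, k}`: of `1_{j}` (`P_x[τ_j < τ_k]`) and of `1_{k}`
  obtain ⟨g, hg⟩ := LevinPeres2017_prop_9_1_exists hP hirr (B := ({j, k} : Set X)) (x := j)
    (Set.mem_insert j {k}) (fun x => if x = j then (1 : ℝ) else 0)
  obtain ⟨q, hq⟩ := LevinPeres2017_prop_9_1_exists hP hirr (B := ({j, k} : Set X)) (x := j)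
    (Set.mem_insert j {k}) (fun x => if x = k then (1 : ℝ) else 0)
  have h1 := hG.col_eq_mul hP hirr hjk hg i
  have h2 := hG.diag_mul_escape hP hirr hjk hq
  have h3 := hh.returnTime_eq_commuteTime_mul_escape hP hirr hjk hq
  have h4 := hh.hitting_sub_hitting_harmonicExt hP hirr hjk hg i
  rw [h1, h3]
  linear_combination (g i * commuteTime h j k) * h2 - h4

end Chung

/-! ### §2 The spanning-forest form and the tree algebra identities (3.6)–(3.7) -/

section TreeAlgebra

/-- **Pitman–Tang's forest form of Chung's formula**: on an irreducible chain, for `j ≠ k` and every `i`,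
`G_{τ_k}(i, j) = (Σ_{ik}Σ_j + Σ_{kj}Σ_k − Σ_{ij}Σ_k) / (Σ_k Σ^{(1)})` (Theorem 1.3 and eq. (1.1)
substituted into Chung's formula). [cite: PitmanTang2018, §3 (the display after (3.5), «Further by
Theorem 1.3, we have …»)] -/
theorem IsGreenSolution.PitmanTang2018_green_forests (hP : IsRowStochastic P) (hirr : IsIrreducible P)
    {k : X} {G : X → X → ℝ} (hG : IsGreenSolution P k G) {j : X} (hjk : j ≠ k) (i : X) :
    G i j = (passageForestSum (fun x y => P x y) i k * treeMeasure P j +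
        passageForestSum (fun x y => P x y) k j * treeMeasure P k -
        passageForestSum (fun x y => P x y) i j * treeMeasure P k) /
      (treeMeasure P k * ∑ l, treeMeasure P l) := by
  haveI : Nonempty X := ⟨i⟩
  obtain ⟨h, hh⟩ := exists_isHittingTimeSolution hP hirr
  have hk : treeMeasure P k ≠ 0 := (treeMeasure_pos hP hirr k).ne'
  have hj : treeMeasure P j ≠ 0 := (treeMeasure_pos hP hirr j).ne'
  have hS : (∑ l, treeMeasure P l) ≠ 0 :=
    (sum_pos (fun l _ => treeMeasure_pos hP hirr l) univ_nonempty).ne'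
  have c := hG.chung_formula hP hirr hh hjk i
  have e2 : (1 + ∑ y, P j y * h y j) * treeMeasure P j = ∑ l, treeMeasure P l := by
    rw [hh.PitmanTang2018_eq_1_1 hP hirr j, div_mul_cancel₀ _ hj]
  have e3 := hh.mul_treeMeasure_eq_passageForestSum hP hirr i k
  have e4 := hh.mul_treeMeasure_eq_passageForestSum hP hirr k j
  have e5 := hh.mul_treeMeasure_eq_passageForestSum hP hirr i j
  rw [eq_div_iff (mul_ne_zero hk hS)]
  linear_combination (treeMeasure P k * treeMeasure P j) * c - (G i j * treeMeasure P k) * e2 +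
    treeMeasure P j * e3 + treeMeasure P k * e4 - treeMeasure P k * e5

/-- **The tree algebra identity (3.7)** (with (3.6) as its diagonal case): on an irreducible chain, for
`j ≠ k` and every `i`, `w_{ij}({j,k}) · Σ^{(1)} + Σ_{ij} · Σ_k = Σ_{ik} · Σ_j + Σ_{kj} · Σ_k` — obtained,
as printed, by identifying the Green tree formula `G_{τ_k}(i,j) = w_{ij}({k,j})/Σ_k` with Chung's
formula («It seems that these identities are non-trivial, and there is no simple bijective proof»).
[cite: PitmanTang2018, §3 eq. (3.7) (and (3.6) for `i = j`)] -/
theorem PitmanTang2018_eq_3_7 (hP : IsRowStochastic P) (hirr : IsIrreducible P) {j k : X}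
    (hjk : j ≠ k) (i : X) :
    forestWeightTo (fun x y => P x y) {j, k} i j * (∑ l, treeMeasure P l) +
        passageForestSum (fun x y => P x y) i j * treeMeasure P k =
      passageForestSum (fun x y => P x y) i k * treeMeasure P j +
        passageForestSum (fun x y => P x y) k j * treeMeasure P k := by
  haveI : Nonempty X := ⟨i⟩
  obtain ⟨G, hG⟩ := exists_isGreenSolution hP hirr k
  have hk : treeMeasure P k ≠ 0 := (treeMeasure_pos hP hirr k).ne'
  have hS : (∑ l, treeMeasure P l) ≠ 0 :=
    (sum_pos (fun l _ => treeMeasure_pos hP hirr l) univ_nonempty).ne'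
  -- (3.5): `G(i,j) Σ_k = w_{ij}({j,k})`
  have e1 : G i j * treeMeasure P k = forestWeightTo (fun x y => P x y) {j, k} i j := by
    rw [hG.PitmanTang2018_green hP hirr i hjk, treeMeasure_eq_forestWeight, div_mul_cancel₀ _ ?_]
    rw [← treeMeasure_eq_forestWeight]
    exact hk
  have c := hG.PitmanTang2018_green_forests hP hirr hjk i
  rw [eq_div_iff (mul_ne_zero hk hS)] at c
  linear_combination c - (∑ l, treeMeasure P l) * e1

/-- **The tree algebra identity (3.6)**: for `j ≠ k`, `w({j,k}) · Σ^{(1)} = Σ_{jk} · Σ_j + Σ_{kj} · Σ_k`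
(the two-tree forests rooted at `{j, k}` against the spanning trees; `w_{jj}({k,j}) = w({j,k})`).
[cite: PitmanTang2018, §3 eq. (3.6)] -/
theorem PitmanTang2018_eq_3_6 (hP : IsRowStochastic P) (hirr : IsIrreducible P) {j k : X}
    (hjk : j ≠ k) :
    forestWeight (fun x y => P x y) {j, k} * (∑ l, treeMeasure P l) =
      passageForestSum (fun x y => P x y) j k * treeMeasure P j +
        passageForestSum (fun x y => P x y) k j * treeMeasure P k := by
  have h := PitmanTang2018_eq_3_7 hP hirr hjk j
  rw [forestWeightTo_self, passageForestSum_self, zero_mul, add_zero] at h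
  exact h

end TreeAlgebra

/-! ### §3 Lyons–Peres Exercise 4.25: the expected number of steps of Wilson's algorithm -/

section Wilson

variable {π : X → ℝ} {h : X → X → ℝ}

/-- **Lyons–Peres, Exercise 4.25 (the cost of Wilson's algorithm rooted at `r`), forest form**: on an
irreducible chain with stationary distribution `π`,
`Σ_x π(x) (E_x τ_r + E_r τ_x) = Σ_{x ≠ r} w({x, r}) / Σ_r` — summing the tree algebra identity (3.6)
over `x ≠ r`. [cite: LyonsPeres2016, §4.6 Exercise 4.25 («the expected number of steps to generate a
random spanning tree rooted at `r` […] is `Σ_x π(x)(E_x[τ_r] + E_r[τ_x])`»)] [cite: PitmanTang2018,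
§3 eq. (3.6)] -/
theorem LyonsPeres2016_exercise_4_25 (hP : IsRowStochastic P) (hirr : IsIrreducible P)
    (hπ : IsStationary π P) (hπ1 : ∑ x, π x = 1) (hh : IsHittingTimeSolution P h) (r : X) :
    ∑ x, π x * (h x r + h r x) =
      (∑ x ∈ univ.erase r, forestWeight (fun x y => P x y) {x, r}) / treeMeasure P r := by
  haveI : Nonempty X := ⟨r⟩
  have hr : treeMeasure P r ≠ 0 := (treeMeasure_pos hP hirr r).ne'
  have hS : (∑ l, treeMeasure P l) ≠ 0 :=
    (sum_pos (fun l _ => treeMeasure_pos hP hirr l) univ_nonempty).ne'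
  rw [LyonsPeres2016_markovChainTree_eq hP hirr hπ hπ1, ← add_sum_erase _ _ (mem_univ r), hh.diag,
    add_zero, mul_zero, zero_add, sum_div]
  refine sum_congr rfl fun x hx => ?_
  have hxr : x ≠ r := ne_of_mem_erase hx
  have e36 := PitmanTang2018_eq_3_6 hP hirr hxr
  have ea := hh.mul_treeMeasure_eq_passageForestSum hP hirr x r
  have eb := hh.mul_treeMeasure_eq_passageForestSum hP hirr r x
  rw [div_mul_eq_mul_div, div_eq_div_iff hS hr]
  linear_combination -1 * e36 + treeMeasure P x * ea + treeMeasure P r * eb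

/-- … **and its second form: the trace of `(I − P_r)⁻¹`** (`P_r` = `P` with the row and column of `r`
deleted) is the same forest ratio `Σ_{x ≠ r} w({x, r}) / Σ_r` (the diagonal of the Green tree formula
(1.5)). [cite: LyonsPeres2016, §4.6 Exercise 4.25 («another expression for this expected time is the
trace of `(I − P_r)^{-1}`»)] [cite: PitmanTang2018, Thm. 1.2 eq. (1.5)] -/
theorem LyonsPeres2016_exercise_4_25_trace (hP : IsRowStochastic P) (hirr : IsIrreducible P) (r : X) :
    Matrix.trace ((((1 : Matrix X X ℝ) - P).submatrix (Subtype.val : ↥(({r} : Finset X)ᶜ) → X)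
        Subtype.val)⁻¹) =
      (∑ x ∈ univ.erase r, forestWeight (fun x y => P x y) {x, r}) / treeMeasure P r := by
  have hw : forestWeight (fun x y => P x y) {r} ≠ 0 :=
    (forestWeight_pos hP hirr (singleton_nonempty r)).ne'
  rw [Matrix.trace, treeMeasure_eq_forestWeight, sum_div, ← compl_singleton,
    ← Finset.sum_coe_sort ({r} : Finset X)ᶜ (fun x => forestWeight (fun x y => P x y) {x, r} /
      forestWeight (fun x y => P x y) {r})]
  refine sum_congr rfl fun x _ => ?_
  rw [Matrix.diag_apply, PitmanTang2018_thm_1_2_inv hP.2 {r} hw x x, forestWeightTo_self]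

end Wilson

end Literature.Probability.MarkovChains
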